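import Summits.CriticalPhenomena.PercolationContinuityZ3.Theorems.PercNearOneGluingNoHeavyPcintBSMWords
import Summits.CriticalPhenomena.PercolationContinuityZ3.Theorems.PercNearOneGluingNoHeavyPcintBSMBlocks
import HarnessLib

/-!
# PCINT lane, PHASE 5 (block-renewal second moment), step 4: the product formula for the block transition sums

Cell `prim-pcint`, seat `prim-pcint-1` (gen 14); memo `run/shared/lean/prim/pcint/T-FIBRE-ROUTE.md` §PHASE 5.

For a piece table `pc` whose endpoints lie in the cube `{-1,0,1}^t` and weights `w` whose endpoint marginal is the
product law `Π_i g₃ s (v i)` (`BSM.Marg`), the transition sums of the pair offset chain of two independent block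
walkers (block weights `ν b = w b.1 / k`) FACTORISE (**`BSM.Pn_eq`**):

  `Pn pc ν n (τ, y) (τ', y') = cnt k n (τ - τ') / k^{2n} · Π_i F s (2n) (y' i - y i)`,

the time offset performing the difference walk of two oriented walks (the tree's `OSM.cnt`) and each transverse
coordinate an independent lazy three-point pair walk (`BSM.F`, …BSMLazy/…BSMWords).  Consequences for the partial
Green sums `Gm` towards targets with time offset `0`: the diagonal class `BSM.Gm_zero_eq`
(`Gm m (0,u) (0,z) = Σ_{i<m} u k i · Π_l F s (2i) (z l - u l)`) and the ADJACENT-CLASS SUM `BSM.sum_Gm_adj_eq`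
(`Σ_{a≠a'} Gm m (e a' - e a, u) (0,z) = Σ_{i<m} (k² u k (i+1) - k u k i) Π_l F …`, from `OSM.cnt_succ`), with the
monotonicity `k² u (i+1) - k u i ≤ k (k-1) u i`.  Also the certificate bound with the true partial Green sums
(`BSM.A_le_of_cert'`).
-/

noncomputable section

namespace Summit.CriticalPhenomena.PercolationContinuityZ3.Theorems.Pcint.BSM

open Finset OSM

variable {t k np : ℕ}

/-! ### The certificate bound with the true partial Green sums -/

/-- **The certificate bound** (variant of `BSM.A_le_of_cert` with the partial Green sums themselves): if for every
horizon `m` and every `o ∈ B`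

  `Σ_{b,b'} ν b ν b' (x^{R o b b'} - 1) (c + Σ_{z ∈ B} Gm m (o + δ b b') z · φ z) ≤ φ o`,

then `A x n 0 ≤ (c + Σ_{z∈B} Gm n 0 z φ z) / c`. -/
theorem A_le_of_cert' (R : Off t k → Blk np k → Blk np k → ℕ) (pc : Fin np → List (Fin t × Bool))
    {ν : Blk np k → ℝ} (hν : ∀ b, 0 ≤ ν b) (hν1 : ∑ b : Blk np k, ν b = 1) {x : ℝ} (hx : 1 ≤ x)
    (B : Finset (Off t k)) (hB : ∀ o b b', R o b b' ≠ 0 → o ∈ B) {φ : Off t k → ℝ} (hφ : ∀ z ∈ B, 0 ≤ φ z)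
    {c : ℝ} (hc : 0 < c)
    (hcert : ∀ m, ∀ o ∈ B, ∑ b : Blk np k, ∑ b' : Blk np k,
      ν b * ν b' * (x ^ R o b b' - 1) * (c + ∑ z ∈ B, Gm pc ν m (o + δ pc b b') z * φ z) ≤ φ o) (n : ℕ) :
    A R pc ν x n 0 ≤ (c + ∑ z ∈ B, Gm pc ν n 0 z * φ z) / c := by
  have hx0 : 0 ≤ x := zero_le_one.trans hx
  set V : ℕ → Off t k → ℝ := fun m o => c + ∑ z ∈ B, Gm pc ν m o z * φ z with hVdef
  have hGm0 : ∀ m o z, 0 ≤ Gm pc ν m o z := fun m o z => sum_nonneg fun i _ => Pn_nonneg pc hν i o z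
  have hVc : ∀ m o, c ≤ V m o := fun m o =>
    le_add_of_nonneg_right (sum_nonneg fun z hz => mul_nonneg (hGm0 m o z) (hφ z hz))
  have hνν : ∑ b : Blk np k, ∑ b' : Blk np k, ν b * ν b' = 1 := by rw [← sum_mul_sum, hν1, one_mul]
  have harm : ∀ m o, ∑ b : Blk np k, ∑ b' : Blk np k, ν b * ν b' * V m (o + δ pc b b') =
      V (m + 1) o - ∑ z ∈ B, (if o = z then 1 else 0) * φ z := by
    intro m o
    have e1 : ∑ b : Blk np k, ∑ b' : Blk np k, ν b * ν b' * V m (o + δ pc b b') =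
        (∑ b : Blk np k, ∑ b' : Blk np k, ν b * ν b' * c) +
          ∑ b : Blk np k, ∑ b' : Blk np k, ∑ z ∈ B, φ z * (ν b * ν b' * Gm pc ν m (o + δ pc b b') z) := by
      rw [← sum_add_distrib]; refine sum_congr rfl fun b _ => ?_
      rw [← sum_add_distrib]; refine sum_congr rfl fun b' _ => ?_
      rw [hVdef]; dsimp only; rw [mul_add, mul_sum]; congr 1; exact sum_congr rfl fun z _ => by ring
    have e2 : ∑ b : Blk np k, ∑ b' : Blk np k, ν b * ν b' * c = c := by
      simp_rw [← sum_mul]; rw [hνν, one_mul]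
    have e3 : ∑ b : Blk np k, ∑ b' : Blk np k, ∑ z ∈ B, φ z * (ν b * ν b' * Gm pc ν m (o + δ pc b b') z) =
        ∑ z ∈ B, φ z * ∑ b : Blk np k, ∑ b' : Blk np k, ν b * ν b' * Gm pc ν m (o + δ pc b b') z := by
      rw [← Fintype.sum_prod_type', Finset.sum_comm]
      refine sum_congr rfl fun z _ => ?_
      rw [← Fintype.sum_prod_type', mul_sum]
    rw [e1, e2, e3]
    simp_rw [sum_Gm pc ν]
    rw [hVdef]; dsimp only
    rw [← sub_eq_zero]
    simp only [mul_sub, sum_sub_distrib]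
    have : ∑ z ∈ B, φ z * Gm pc ν (m + 1) o z = ∑ z ∈ B, Gm pc ν (m + 1) o z * φ z :=
      sum_congr rfl fun z _ => mul_comm _ _
    have : ∑ z ∈ B, φ z * (if o = z then (1 : ℝ) else 0) = ∑ z ∈ B, (if o = z then (1 : ℝ) else 0) * φ z :=
      sum_congr rfl fun z _ => mul_comm _ _
    linarith
  have hrew : ∀ m o, ∑ b : Blk np k, ∑ b' : Blk np k,
      ν b * ν b' * (x ^ R o b b' - 1) * V m (o + δ pc b b') ≤ ∑ z ∈ B, (if o = z then 1 else 0) * φ z := by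
    intro m o
    have hrhs : ∑ z ∈ B, (if o = z then (1 : ℝ) else 0) * φ z = if o ∈ B then φ o else 0 := by
      simp_rw [boole_mul]; exact sum_ite_eq B o φ
    rw [hrhs]
    by_cases ho : o ∈ B
    · rw [if_pos ho]; exact hcert m o ho
    · rw [if_neg ho]
      refine le_of_eq (sum_eq_zero fun b _ => sum_eq_zero fun b' _ => ?_)
      have : R o b b' = 0 := by
        by_contra h; exact ho (hB o b b' h)
      rw [this, pow_zero, sub_self, mul_zero, zero_mul]
  have hstep : ∀ m o, ∑ b : Blk np k, ∑ b' : Blk np k, ν b * ν b' * x ^ R o b b' * V m (o + δ pc b b') ≤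
      V (m + 1) o := by
    intro m o
    have hsplit : ∑ b : Blk np k, ∑ b' : Blk np k, ν b * ν b' * x ^ R o b b' * V m (o + δ pc b b') =
        (∑ b : Blk np k, ∑ b' : Blk np k, ν b * ν b' * V m (o + δ pc b b')) +
          ∑ b : Blk np k, ∑ b' : Blk np k, ν b * ν b' * (x ^ R o b b' - 1) * V m (o + δ pc b b') := by
      rw [← sum_add_distrib]; refine sum_congr rfl fun b _ => ?_
      rw [← sum_add_distrib]; refine sum_congr rfl fun b' _ => ?_
      ring
    have hφ0 : 0 ≤ ∑ z ∈ B, (if o = z then (1 : ℝ) else 0) * φ z :=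
      sum_nonneg fun z hz => mul_nonneg (by split_ifs <;> norm_num) (hφ z hz)
    rw [hsplit, harm]
    linarith [hrew m o]
  exact A_le_of_potential R pc hν hx0 hc hVc hstep n 0

/-! ### Coding cube points by letters -/

/-- The letter of an integer in `{-1, 0, 1}` (total: anything else is sent to `2`). -/
def code (x : ℤ) : Fin 3 := if x = -1 then 0 else if x = 0 then 1 else 2

/-- `val (code x) = x` on the cube. -/
theorem val_code {x : ℤ} (hx : x = -1 ∨ x = 0 ∨ x = 1) : val (code x) = x := by
  unfold code val
  rcases hx with h | h | h <;> subst h <;> simp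

/-- The letters of a piece endpoint. -/
def codev (pc : Fin np → List (Fin t × Bool)) (σ : Fin np) : Fin t → Fin 3 := fun i => code (pend (pc σ) i)

/-- **Cube hypothesis**: all piece endpoints lie in `{-1,0,1}^t`. -/
def Cube (pc : Fin np → List (Fin t × Bool)) : Prop :=
  ∀ σ i, pend (pc σ) i = -1 ∨ pend (pc σ) i = 0 ∨ pend (pc σ) i = 1

/-- **Marginal hypothesis**: the endpoint law of a `w`-random piece is the product law `Π_i g₃ s (v i)`. -/
def Marg (pc : Fin np → List (Fin t × Bool)) (w : Fin np → ℝ) (s : ℝ) : Prop :=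
  ∀ v : Fin t → Fin 3, ∑ σ : Fin np, (if codev pc σ = v then w σ else 0) = ∏ i, g₃ s (v i)

/-- Under the cube hypothesis the endpoint is read off its letters. -/
theorem pend_eq_val_codev {pc : Fin np → List (Fin t × Bool)} (hc : Cube pc) (σ : Fin np) :
    pend (pc σ) = fun i => val (codev pc σ i) := by
  funext i; exact (val_code (hc σ i)).symm

/-- The block weights `ν b = w b.1 / k`. -/
def νw (k : ℕ) (w : Fin np → ℝ) (b : Blk np k) : ℝ := w b.1 / k

/-- The block weights sum to one when the piece weights do (`k ≥ 1`). -/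
theorem sum_νw {w : Fin np → ℝ} (hk : 0 < k) (hw : ∑ σ, w σ = 1) : ∑ b : Blk np k, νw k w b = 1 := by
  have hk0 : (k : ℝ) ≠ 0 := by exact_mod_cast hk.ne'
  rw [Fintype.sum_prod_type]
  simp only [νw, sum_const, card_univ, Fintype.card_fin, nsmul_eq_mul]
  have : ∀ x : Fin np, (k : ℝ) * (w x / k) = w x := fun x => by field_simp
  simp_rw [this, hw]

/-- The piece weights sum to one under the marginal hypothesis. -/
theorem sum_w_of_marg {pc : Fin np → List (Fin t × Bool)} {w : Fin np → ℝ} {s : ℝ} (hm : Marg pc w s) :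
    ∑ σ, w σ = 1 := by
  have hm' : ∀ v : Fin t → Fin 3, ∑ σ : Fin np, (if codev pc σ = v then w σ else 0) = ∏ i, g₃ s (v i) := hm
  have h1 : ∑ σ : Fin np, w σ = ∑ v : Fin t → Fin 3, ∑ σ : Fin np, if codev pc σ = v then w σ else 0 := by
    rw [sum_comm]
    refine sum_congr rfl fun σ _ => ?_
    rw [sum_ite_eq]; simp
  rw [h1]
  simp_rw [hm']
  rw [← Fintype.prod_sum]
  simp [sum_g₃]

/-! ### The product formula -/

/-- The letter map of a pair of blocks: time axes and endpoint letters. -/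
def Φ (pc : Fin np → List (Fin t × Bool)) (p : Blk np k × Blk np k) : (Fin k × Fin k) × (Fin t → Fin 3 × Fin 3) :=
  ((p.1.2, p.2.2), fun i => (codev pc p.1.1 i, codev pc p.2.1 i))

/-- The offset increment read off the letters. -/
def Dℓ (ℓ : (Fin k × Fin k) × (Fin t → Fin 3 × Fin 3)) : Off t k :=
  (e ℓ.1.2 - e ℓ.1.1, fun i => val (ℓ.2 i).2 - val (ℓ.2 i).1)

/-- Under the cube hypothesis `δ = Dℓ ∘ Φ`. -/
theorem δ_eq_Dℓ {pc : Fin np → List (Fin t × Bool)} (hc : Cube pc) (p : Blk np k × Blk np k) :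
    δ pc p.1 p.2 = Dℓ (Φ pc p) := by
  unfold δ Dℓ Φ
  simp only
  rw [pend_eq_val_codev hc, pend_eq_val_codev hc]
  rfl

/-- **The fibre weights of `Φ`**: `Σ_{Φ p = ℓ} ν p.1 ν p.2 = (1/k²) Π_i g₃(ℓ.2 i).1 g₃(ℓ.2 i).2`. -/
theorem fibre_Φ {pc : Fin np → List (Fin t × Bool)} {w : Fin np → ℝ} {s : ℝ} (hm : Marg pc w s) (hk : 0 < k)
    (ℓ : (Fin k × Fin k) × (Fin t → Fin 3 × Fin 3)) :
    ∑ p : Blk np k × Blk np k, (if Φ pc p = ℓ then νw k w p.1 * νw k w p.2 else 0) =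
      (1 : ℝ) / (k : ℝ) ^ 2 * ∏ i, (g₃ s (ℓ.2 i).1 * g₃ s (ℓ.2 i).2) := by
  have hk0 : (k : ℝ) ≠ 0 := by exact_mod_cast hk.ne'
  have hm' : ∀ v : Fin t → Fin 3, ∑ σ : Fin np, (if codev pc σ = v then w σ else 0) = ∏ i, g₃ s (v i) := hm
  set v₁ : Fin t → Fin 3 := fun i => (ℓ.2 i).1 with hv₁
  set v₂ : Fin t → Fin 3 := fun i => (ℓ.2 i).2 with hv₂
  -- the condition splits into four independent ones
  have hcond : ∀ p : Blk np k × Blk np k, (Φ pc p = ℓ) ↔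
      ((p.1.2 = ℓ.1.1 ∧ codev pc p.1.1 = v₁) ∧ (p.2.2 = ℓ.1.2 ∧ codev pc p.2.1 = v₂)) := by
    intro p
    unfold Φ
    rw [Prod.ext_iff, Prod.ext_iff]
    simp only
    constructor
    · rintro ⟨⟨h1, h2⟩, h3⟩
      refine ⟨⟨h1, ?_⟩, h2, ?_⟩
      · funext i; exact congr_arg Prod.fst (congr_fun h3 i)
      · funext i; exact congr_arg Prod.snd (congr_fun h3 i)
    · rintro ⟨⟨h1, h3⟩, h2, h4⟩
      refine ⟨⟨h1, h2⟩, ?_⟩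
      funext i; exact Prod.ext (congr_fun h3 i) (congr_fun h4 i)
  -- the two factors
  set F₁ : Blk np k → ℝ := fun b =>
    (if b.2 = ℓ.1.1 then (1 : ℝ) else 0) * (if codev pc b.1 = v₁ then w b.1 / k else 0) with hF₁
  set F₂ : Blk np k → ℝ := fun b =>
    (if b.2 = ℓ.1.2 then (1 : ℝ) else 0) * (if codev pc b.1 = v₂ then w b.1 / k else 0) with hF₂
  -- termwise factorisation
  have hterm : ∀ p : Blk np k × Blk np k, (if Φ pc p = ℓ then νw k w p.1 * νw k w p.2 else 0) =
      F₁ p.1 * F₂ p.2 := by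
    intro p
    rw [if_congr (hcond p) rfl rfl, hF₁, hF₂]
    unfold νw
    dsimp only
    by_cases h1 : p.1.2 = ℓ.1.1 <;> by_cases h2 : codev pc p.1.1 = v₁ <;> by_cases h3 : p.2.2 = ℓ.1.2 <;>
      by_cases h4 : codev pc p.2.1 = v₂ <;> simp [h1, h2, h3, h4]
  have hfac : ∀ (α : Fin k) (v : Fin t → Fin 3), ∑ b : Blk np k,
      (if b.2 = α then (1 : ℝ) else 0) * (if codev pc b.1 = v then w b.1 / k else 0) = (∏ i, g₃ s (v i)) / k := by
    intro α v
    rw [Fintype.sum_prod_type, ← hm', sum_div]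
    dsimp only
    refine sum_congr rfl fun σ _ => ?_
    have e : ∀ y : Fin k, (if y = α then (1 : ℝ) else 0) * (if codev pc σ = v then w σ / k else 0) =
        if y = α then (if codev pc σ = v then w σ / k else 0) else 0 := fun y => by
      split_ifs <;> simp
    simp_rw [e]
    rw [sum_ite_eq']
    simp only [mem_univ, if_true]
    split_ifs <;> simp
  calc ∑ p : Blk np k × Blk np k, (if Φ pc p = ℓ then νw k w p.1 * νw k w p.2 else 0)
      = ∑ p : Blk np k × Blk np k, F₁ p.1 * F₂ p.2 := sum_congr rfl fun p _ => hterm p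
    _ = ∑ b : Blk np k, ∑ b' : Blk np k, F₁ b * F₂ b' := Fintype.sum_prod_type _
    _ = (∑ b : Blk np k, F₁ b) * ∑ b' : Blk np k, F₂ b' := (sum_mul_sum _ _ _ _).symm
    _ = (∏ i, g₃ s (v₁ i)) / k * ((∏ i, g₃ s (v₂ i)) / k) := by rw [hF₁, hF₂, hfac, hfac]
    _ = (1 : ℝ) / (k : ℝ) ^ 2 * ∏ i, (g₃ s (ℓ.2 i).1 * g₃ s (ℓ.2 i).2) := by
        rw [prod_mul_distrib]
        simp only [hv₁, hv₂]
        field_simp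

/-- **The product formula** for the block transition sums. -/
theorem Pn_eq {pc : Fin np → List (Fin t × Bool)} {w : Fin np → ℝ} {s : ℝ} (hc : Cube pc) (hm : Marg pc w s)
    (hk : 0 < k) (n : ℕ) (τ τ' : Fin k → ℤ) (y y' : Fin t → ℤ) :
    Pn pc (νw k w) n (τ, y) (τ', y') = cnt k n (τ - τ') / (k : ℝ) ^ (2 * n) * ∏ i, F s (2 * n) (y' i - y i) := by
  -- Step 1: words of pairs; the final offset is the sum of the letter increments
  have h1 : Pn pc (νw k w) n (τ, y) (τ', y') = ∑ ξ : Fin n → Blk np k × Blk np k,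
      (∏ j, (νw k w (ξ j).1 * νw k w (ξ j).2)) *
        (if (τ, y) + ∑ j, Dℓ (Φ pc (ξ j)) = (τ', y') then (1 : ℝ) else 0) := by
    unfold Pn
    rw [sum_pair_eq (fun β β' : Fin n → Blk np k =>
      wt' (νw k w) β * wt' (νw k w) β' * if offAt pc (τ, y) β β' n = (τ', y') then (1 : ℝ) else 0)]
    refine sum_congr rfl fun ξ _ => ?_
    rw [wt', wt', ← prod_mul_distrib]
    unfold offAt
    simp only [Fin.is_lt, if_true, δ_eq_Dℓ hc]
  -- Step 2: push forward along `Φ`, fibre weights by `fibre_Φ`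
  have h2 := sum_prod_comp (Φ pc) (fun p : Blk np k × Blk np k => νw k w p.1 * νw k w p.2) n
    (fun η => if (τ, y) + ∑ j, Dℓ (η j) = (τ', y') then (1 : ℝ) else 0)
  simp only [Function.comp_def, fibre_Φ hm hk] at h2
  rw [h1, h2]
  -- Step 3: split the indicator and factorise time / transverse
  have hind : ∀ η : Fin n → (Fin k × Fin k) × (Fin t → Fin 3 × Fin 3),
      (if (τ, y) + ∑ j, Dℓ (η j) = (τ', y') then (1 : ℝ) else 0) =
        (if τ + ∑ j, (e (η j).1.2 - e (η j).1.1) = τ' then (1 : ℝ) else 0) *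
          (if y + ∑ j, (fun i => val ((η j).2 i).2 - val ((η j).2 i).1) = y' then (1 : ℝ) else 0) := by
    intro η
    rw [ite_zero_mul_ite_zero, one_mul]
    refine if_congr ?_ rfl rfl
    rw [Prod.ext_iff, Prod.fst_add, Prod.snd_add, Prod.fst_sum, Prod.snd_sum]
    rfl
  simp_rw [hind]
  have h3 := sum_prod_mul_factor (n := n) (fun _ : Fin k × Fin k => (1 : ℝ) / (k : ℝ) ^ 2)
    (fun m : Fin t → Fin 3 × Fin 3 => ∏ i, (g₃ s (m i).1 * g₃ s (m i).2))
    (fun α => if τ + ∑ j, (e (α j).2 - e (α j).1) = τ' then (1 : ℝ) else 0)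
    (fun ζ => if y + ∑ j, (fun i => val ((ζ j) i).2 - val ((ζ j) i).1) = y' then (1 : ℝ) else 0)
  simp only at h3
  rw [h3, time_sum_eq_cnt hk]
  congr 1
  -- Step 4: the transverse factor, coordinate by coordinate
  have hvec : ∀ ζ : Fin n → (Fin t → Fin 3 × Fin 3),
      (if y + ∑ j, (fun i => val ((ζ j) i).2 - val ((ζ j) i).1) = y' then (1 : ℝ) else 0) =
        ∏ i, (if y i + ∑ j, (val ((ζ j) i).2 - val ((ζ j) i).1) = y' i then (1 : ℝ) else 0) := by
    intro ζ
    have hiff : (y + ∑ j, (fun i => val ((ζ j) i).2 - val ((ζ j) i).1) = y') ↔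
        ∀ i, y i + ∑ j, (val ((ζ j) i).2 - val ((ζ j) i).1) = y' i := by
      rw [funext_iff]
      refine forall_congr' fun i => ?_
      rw [Pi.add_apply, Finset.sum_apply]
    by_cases hV : y + ∑ j, (fun i => val ((ζ j) i).2 - val ((ζ j) i).1) = y'
    · rw [if_pos hV]; exact (prod_eq_one fun i _ => if_pos ((hiff.1 hV) i)).symm
    · rw [if_neg hV]
      obtain ⟨i, hi⟩ := not_forall.1 (mt hiff.2 hV)
      exact (prod_eq_zero (mem_univ i) (if_neg hi)).symm
  simp_rw [hvec]
  rw [sum_prod_pi_factor t n (fun c : Fin 3 × Fin 3 => g₃ s c.1 * g₃ s c.2)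
    (fun i ζ => if y i + ∑ j, (val (ζ j).2 - val (ζ j).1) = y' i then (1 : ℝ) else 0)]
  refine prod_congr rfl fun i _ => ?_
  rw [← Apair_eq_F, Apair]
  refine sum_congr rfl fun ζ _ => ?_
  congr 1
  refine if_congr ?_ rfl rfl
  constructor <;> intro h <;> linarith

/-! ### Partial Green sums towards time offset zero -/

/-- **The diagonal class**: `Gm m (0,u) (0,z) = Σ_{i<m} u k i · Π_l F s (2i) (z l - u l)`. -/
theorem Gm_zero_eq {pc : Fin np → List (Fin t × Bool)} {w : Fin np → ℝ} {s : ℝ} (hc : Cube pc) (hm : Marg pc w s)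
    (hk : 0 < k) (m : ℕ) (x z : Fin t → ℤ) :
    Gm pc (νw k w) m (0, x) (0, z) = ∑ i ∈ range m, u k i * ∏ l, F s (2 * i) (z l - x l) := by
  unfold Gm
  refine sum_congr rfl fun i _ => ?_
  rw [Pn_eq hc hm hk, sub_zero, OSM.u]

/-- `cnt` is even in its offset. -/
theorem cnt_neg (i : ℕ) (y : Fin k → ℤ) : cnt k i (-y) = cnt k i y := by
  unfold cnt
  rw [sum_comm]
  refine sum_congr rfl fun w _ => sum_congr rfl fun w' _ => ?_
  refine if_congr ?_ rfl rfl
  constructor <;> intro hh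
  · linear_combination (-1 : ℤ) • hh
  · linear_combination (-1 : ℤ) • hh

/-- **The adjacent offsets summed**: `Σ_{a ≠ a'} cnt i (e a' - e a) = cnt (i+1) 0 - k cnt i 0` (`OSM.cnt_succ`). -/
theorem sum_cnt_adj (i : ℕ) :
    ∑ a : Fin k, ∑ a' : Fin k, (if a = a' then 0 else cnt k i (e a' - e a)) = cnt k (i + 1) 0 - k * cnt k i 0 := by
  rw [cnt_succ]
  have hdiag : ∑ a : Fin k, ∑ a' : Fin k, (if a = a' then cnt k i (0 + e a - e a') else 0) = k * cnt k i 0 := by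
    simp_rw [sum_ite_eq, if_pos (mem_univ _), add_sub_cancel_right]
    rw [sum_const, card_univ, Fintype.card_fin, nsmul_eq_mul]
  rw [← hdiag, ← sum_sub_distrib]
  refine sum_congr rfl fun a _ => ?_
  rw [← sum_sub_distrib]
  refine sum_congr rfl fun a' _ => ?_
  by_cases h : a = a'
  · subst h; simp
  · rw [if_neg h, if_neg h, sub_zero, zero_add, ← cnt_neg i (e a' - e a), neg_sub]

/-- The adjacent-class coefficient `k² u (i+1) - k u i` is nonnegative … -/
theorem adj_coeff_nonneg (hk : 0 < k) (i : ℕ) : 0 ≤ (k : ℝ) ^ 2 * u k (i + 1) - k * u k i := by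
  have hk0 : (0 : ℝ) < k := by exact_mod_cast hk
  have h : (k : ℝ) ^ 2 * u k (i + 1) - k * u k i = (cnt k (i + 1) 0 - k * cnt k i 0) / (k : ℝ) ^ (2 * i) := by
    rw [OSM.u, OSM.u, show (k : ℝ) ^ (2 * (i + 1)) = (k : ℝ) ^ (2 * i) * (k : ℝ) ^ 2 by ring]
    field_simp
  rw [h, ← sum_cnt_adj]
  exact div_nonneg (sum_nonneg fun a _ => sum_nonneg fun a' _ => by
    split_ifs
    · exact le_rfl
    · exact cnt_nonneg _ _) (by positivity)

/-- … and at most `k (k-1) u i` (`u` is non-increasing). -/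
theorem adj_coeff_le (hk : 0 < k) (i : ℕ) :
    (k : ℝ) ^ 2 * u k (i + 1) - k * u k i ≤ (k : ℝ) * ((k : ℝ) - 1) * u k i := by
  have h := u_succ_le hk i
  nlinarith [mul_le_mul_of_nonneg_left h (by positivity : (0 : ℝ) ≤ (k : ℝ) ^ 2)]

/-- **The adjacent classes summed**:
`Σ_{a,a'} [a ≠ a'] Gm m (e a' - e a, u) (0,z) = Σ_{i<m} (k² u k (i+1) - k u k i) Π_l F s (2i) (z l - u l)`. -/
theorem sum_Gm_adj_eq {pc : Fin np → List (Fin t × Bool)} {w : Fin np → ℝ} {s : ℝ} (hc : Cube pc)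
    (hm : Marg pc w s) (hk : 0 < k) (m : ℕ) (x z : Fin t → ℤ) :
    ∑ a : Fin k, ∑ a' : Fin k, (if a = a' then 0 else Gm pc (νw k w) m (e a' - e a, x) (0, z)) =
      ∑ i ∈ range m, ((k : ℝ) ^ 2 * u k (i + 1) - k * u k i) * ∏ l, F s (2 * i) (z l - x l) := by
  have hk0 : (0 : ℝ) < k := by exact_mod_cast hk
  unfold Gm
  simp_rw [Pn_eq hc hm hk, sub_zero]
  rw [show (∑ a : Fin k, ∑ a' : Fin k, if a = a' then (0 : ℝ) else
      ∑ i ∈ range m, cnt k i (e a' - e a) / (k : ℝ) ^ (2 * i) * ∏ l, F s (2 * i) (z l - x l)) =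
      ∑ a : Fin k, ∑ a' : Fin k, ∑ i ∈ range m, (if a = a' then (0 : ℝ) else cnt k i (e a' - e a)) /
        (k : ℝ) ^ (2 * i) * ∏ l, F s (2 * i) (z l - x l) from
    sum_congr rfl fun a _ => sum_congr rfl fun a' _ => by split_ifs <;> simp]
  rw [← Fintype.sum_prod_type', sum_comm]
  refine sum_congr rfl fun i _ => ?_
  rw [Fintype.sum_prod_type]
  dsimp only
  simp_rw [← sum_mul, ← sum_div]
  rw [sum_cnt_adj i, OSM.u, OSM.u]
  have hk2 : (k : ℝ) ^ (2 * (i + 1)) = (k : ℝ) ^ (2 * i) * (k : ℝ) ^ 2 := by ring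
  rw [hk2]
  field_simp

end Summit.CriticalPhenomena.PercolationContinuityZ3.Theorems.Pcint.BSM

end
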